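import Summits.AtomisticToContinuum.HydrodynamicLimit.Theses.HeatBathForgetting
import Summits.AtomisticToContinuum.HydrodynamicLimit.Theses.ImplosionDichotomy
import Literature.MathematicalPhysics.KineticTheory.HardSphereEulerProofs

/-!
# Birth skeleton (BC3) for crux `ClosureToEntropy` — stmt-AtomisticToContinuum-9453
(route `HeatBathForgetting`, rank 5, sub-problem `AtomisticToContinuum/HydrodynamicLimit`)

Crux (FIXED, concluded BY NAME):
`Summit.AtomisticToContinuum.HydrodynamicLimit.Theses.HeatBathForgetting.ClosureToEntropy :=
   MesoFluxClosure → CubicMomentUI → ⟨text of RelEntropyVanishing (stmt-0766) verbatim⟩` —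
"Yau's Grönwall given the one-block input": with `ψ_s` the local Gibbs law fitted to the Euler solution,
`H(f_t | ψ_t)/(N+1) → 0`, plus the probability / exponential-concentration clauses of the reference laws.

## The cut (OllaVaradhanYau1993 §3 / Yau1991 / KipnisLandim1999 Ch. 6, re-read for this crux)

* `stub_initialPinning` (M, provable now) — the `t = 0` field convergence PINS the Euler data: `u 0 = u₀`,
  `θ 0 = θ₀`, and the initial local Gibbs law's density field concentrates exponentially around `ρ 0`
  (landed `LocalGibbsConcentration` + uniqueness of limits in probability + continuity; cf. the tree's
  `PolynomialCompressionPDE.data_eq_of_flowFree`). Gives `H(f_0 | ψ_0) = 0`.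
* `stub_referenceFitInBand` (L, statics) — INVERSE EQUATION OF STATE along the solution, in band: a jointly smooth
  positive activity family `a` on `[0,t]` whose local Gibbs laws `ψ_s = localGibbsLaw σ (a s) (u s) (θ s)` are
  probability measures with fields concentrating exponentially around `(ρ_s, ρ_s u_s, E_s)` UNIFORMLY in
  `s ≤ t`, and `ψ_0 = f_0` as measures (activity inversion is unique up to scale; `thermoActivity`,
  `ActivityInversionDilute` in the tree). Needs the packing guard `ρ_s σ³ < η₂` (cluster regime).
* `stub_blockFluctuationsInBand` (L, statics; the planner's foreseen "MesoscopicPressureFunctional") — the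
  block-scale large-deviation upper bound for `ψ_s` in the only form Yau's proof consumes it: ENTROPY-INEQUALITY
  control of the TRUNCATED quadratic block fluctuations at every mesoscopic scale `h = (N+1)^(-α)`, `α < 1/3`:
  `E_μ[∫ min(K, |ξ_h − U_s|²)] ≤ C_K · H(μ | ψ_s)/(N+1) + ε_N` for every probability `μ`, `ε_N → 0`.
* `stub_blockPackingTails` (L / OPEN, a priori — the DENSITY twin of `CubicMomentUI`): along the true evolution,
  mesoscopic blocks exceed packing `η'` (twice the Euler packing cap) only on a set of vanishing
  `(1 + e_h + |p_h|)`-weighted mean volume. The relative-entropy method controls only events of LD cost `≍ N`,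
  never single blocks (`n_h = (N+1)^(1-3α) ≪ N`), and the typed virial pressure `hsPressure` is junk-laden above
  the analyticity band (HsEosLowDensity), so the Euler-flux remainder on over-packed blocks needs this input —
  exactly as the velocity tails need `CubicMomentUI` (HighMomentumCutoffBarrier).
* `stub_entropyGronwall` (XL, HARDEST — the heart) — YAU'S IDENTITY + GRÖNWALL: for the deterministic
  Liouville flow `H(f_t|ψ_t) − H(f_0|ψ_0) = −E_P[log ψ_t(z_t) − log ψ_0(z_0)]` exactly (entropy of `f_t` is
  conserved); `log ψ_s = (N+1)⟨ξ, λ_s⟩ − log Z_N(s)` is linear in the empirical conserved fields; increments of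
  `⟨ξ, λ_s⟩` are given in mean by `MesoFluxClosure` (energy, momentum) and EXACTLY by free transport (mass:
  `d/ds Σ ζ(x_i) = Σ ∇ζ(x_i)·v_i` on every hard-sphere trajectory — proved inside, no stub); the Euler equations in
  entropy variables kill the linear part (`∂_s λ + (DF)^T ∇λ = 0`, `d/ds log Z_N/(N+1) → ∫ U_s·∂_sλ_s`); the
  quadratic remainder is `≤ C·H/(N+1) + o(1)` by `stub_blockFluctuationsInBand`, its large-field part by
  `CubicMomentUI` (velocities, Hölder `e_h^{3/2} ρ_h^{-1/2} ≤ block |v|³`) and `stub_blockPackingTails`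
  (packing); `H(0) = 0` by the pinned law; Grönwall. MEAN-form closure suffices because the microscopic current
  enters only inside `E_P[·]` against the smooth weight `∇λ_s` (the crux's own bet).
* by NAME, the shared open item `ImplosionDichotomy.DiluteSelfConsistency` (stmt-AtomisticToContinuum-3091,
  "the hidden PDE crux of every route"): pinned classical solutions stay dilute as `σ → 0`. The crux is typed
  against the UNGUARDED conclusion (`∃ σ₀` before `∀ T ∀ solution`), so some hypothesis must exclude dense
  excursions (route ImplosionDichotomy: `PolynomialCompression` PROVED, `DenseExcursion` open); every statics
  stub above is honest only in band, and this is where the band comes from. REPAIRABLE note for the tenure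
  planner: restating `ClosureToEntropy` with the Statement's packing guard drops this hypothesis.

Composition `ClosureToEntropy_of` (PROVED, ≈ 45 lines, not a one-line seam): thresholds `η := min η₂ η₃ η₄`,
`σ₀ := min` of six, `isProbabilityMeasure_localGibbsLaw` (σ ≤ 1/2) for the crux's first conjunct, the guard from
`DiluteSelfConsistency`, then pinning → fit → block bound / packing tails → Grönwall, and the crux's `∃ a` is `a t`.

Disproof used: none — the crux has no `Disproof.lean` / Negative lemmas yet (`ledger crux ls` empty,
negatives index 2026-08-17: no entry on 9450–9455). Barriers honoured: HighMomentumCutoffBarrier(Narrow) —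
velocity tails enter only through the hypothesis `CubicMomentUI`, packing tails through `stub_blockPackingTails`;
BoltzmannHypothesisBarrierNarrow — the flux-level input is the hypothesis `MesoFluxClosure`, not derived here.
-/

noncomputable section

open MeasureTheory Filter Set Topology InformationTheory
open scoped ENNReal BigOperators

namespace Summit.AtomisticToContinuum.HydrodynamicLimit.Cruxes.ClosureToEntropy.Birth

open Literature.MathematicalPhysics.KineticTheory Literature.Analysis.FluidPDE Literature.Analysis.FunctionSpaces
open Summit.AtomisticToContinuum.HydrodynamicLimit.Theses
open Summit.AtomisticToContinuum.HydrodynamicLimit.Theses.HeatBathForgetting (MesoFluxClosure CubicMomentUI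
  ClosureToEntropy)

/-! ### Vocabulary (abbreviations of the crux's own expressions; no new mathematics) -/

/-- The crux's flow type: hard-sphere flows of `N + 1` spheres of diameter `σ(N+1)^{-1/3}` on `𝕋³`. -/
abbrev Flow (σ : ℝ) (N : ℕ) : Type :=
  HardSphereFlow (Torus.geometry (Fin 3)) (hsDiameter σ N) (N + 1)

/-- The crux's exponential concentration bound `C e^{-(N+1)/C}` (as an `ℝ≥0∞`). -/
abbrev expBound (C : ℝ) (N : ℕ) : ℝ≥0∞ :=
  ENNReal.ofReal (C * Real.exp (-(C⁻¹ * (N + 1))))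

/-- The crux's reference-concentration clause at ONE time, uniformly over flows: the three empirical fields of
`localGibbsLaw σ b ub θb` concentrate exponentially (constant `C`, particle number `N + 1`) around
`(ρb, ρb ub, E(ρb, ub, θb))` tested against `χ` — verbatim the three inequalities of `ClosureToEntropy`'s
`∃ a` clause. -/
def RefFieldsConcentrate (σ : ℝ) (b ρb θb : T3 → ℝ) (ub : T3 → V3) (χ : T3 → ℝ) (δ C : ℝ) (N : ℕ) : Prop :=
  ∀ Ψ : Flow σ N,
    localGibbsLaw σ b ub θb N Ψ {z | δ < |empiricalDensityField z χ - ∫ x, χ x * ρb x|} ≤ expBound C N ∧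
    localGibbsLaw σ b ub θb N Ψ {z | δ < ‖empiricalMomentumField z χ - ∫ x, (χ x * ρb x) • ub x‖}
      ≤ expBound C N ∧
    localGibbsLaw σ b ub θb N Ψ
      {z | δ < |empiricalEnergyField z χ - ∫ x, χ x * totalEnergyDensity (ρb x) (ub x) (θb x)|} ≤ expBound C N

/-- FIT ON `[0, t]`: the reference local Gibbs laws `ψ_s = localGibbsLaw σ (a s) (u s) (θ s)` are probability
measures and their fields concentrate exponentially around `(ρ_s, ρ_s u_s, E_s)`, with constants UNIFORM in
`s ∈ [0, t]` (and in the flow). -/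
def FitOn (σ : ℝ) (a ρ θ : ℝ → T3 → ℝ) (u : ℝ → T3 → V3) (t : ℝ) : Prop :=
  (∀ s ∈ Set.Icc 0 t, ∀ (N : ℕ) (Ψ : Flow σ N), IsProbabilityMeasure (localGibbsLaw σ (a s) (u s) (θ s) N Ψ)) ∧
  ∀ χ : T3 → ℝ, Continuous χ → ∀ δ : ℝ, 0 < δ → ∃ C : ℝ, 0 < C ∧
    ∀ s ∈ Set.Icc 0 t, ∀ N : ℕ, RefFieldsConcentrate σ (a s) (ρ s) (θ s) (u s) χ δ C N

/-- The mesoscopic block scale `h_N = (N+1)^{-α}` of `MesoFluxClosure`. -/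
abbrev blockScale (α : ℝ) (N : ℕ) : ℝ :=
  ((N + 1 : ℕ) : ℝ) ^ (-α)

variable {N : ℕ}

/-- Block (kernel-mollified) empirical density at `x`, scale `h` — verbatim the `let ρb` of `MesoFluxClosure`. -/
abbrev blockDensity (h : ℝ) (z : Config (N + 1) (Fin 3) T3) (x : T3) : ℝ :=
  empiricalDensityField z (fun y => Torus.kernel h (y - x))

/-- Block empirical momentum at `x`, scale `h` — verbatim the `let mb` of `MesoFluxClosure`. -/
abbrev blockMomentum (h : ℝ) (z : Config (N + 1) (Fin 3) T3) (x : T3) : V3 :=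
  empiricalMomentumField z (fun y => Torus.kernel h (y - x))

/-- Block empirical energy at `x`, scale `h` — verbatim the `let eb` of `MesoFluxClosure`. -/
abbrev blockEnergy (h : ℝ) (z : Config (N + 1) (Fin 3) T3) (x : T3) : ℝ :=
  empiricalEnergyField z (fun y => Torus.kernel h (y - x))

/-- Block virial pressure `p = hsPressure σ ρ_h θ_h`, `θ_h = (2/3)(e_h/ρ_h − |m_h|²/(2ρ_h²))` — verbatim the
`let pb` of `MesoFluxClosure`. -/
abbrev blockPressure (σ h : ℝ) (z : Config (N + 1) (Fin 3) T3) (x : T3) : ℝ :=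
  hsPressure σ (blockDensity h z x)
    (2 / 3 * (blockEnergy h z x / blockDensity h z x - ‖blockMomentum h z x‖ ^ 2 / (2 * blockDensity h z x ^ 2)))

/-- The TRUNCATED quadratic block-fluctuation functional `∫_{𝕋³} min(K, |ξ_h(z)(x) − U(x)|²) dx` around the
macroscopic state `U = (ρb, ρb ub, E(ρb, ub, θb))`. -/
def quadFluct (K h : ℝ) (ρb θb : T3 → ℝ) (ub : T3 → V3) (z : Config (N + 1) (Fin 3) T3) : ℝ :=
  ∫ x, min K ((blockDensity h z x - ρb x) ^ 2 + ‖blockMomentum h z x - ρb x • ub x‖ ^ 2 +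
    (blockEnergy h z x - totalEnergyDensity (ρb x) (ub x) (θb x)) ^ 2)

/-- BLOCK BOUND on `[0, t]` at scale exponent `α`: for every truncation level `K` there are `C` and `ε_N → 0` with
`E_μ[quadFluct_K] ≤ C · H(μ | ψ_s)/(N+1) + ε_N` for every `s ≤ t`, every `N`, every flow and every probability
measure `μ` (entropy inequality + block large deviations for the reference law `ψ_s`; in `ℝ≥0∞`, so a `μ` not
absolutely continuous w.r.t. `ψ_s` makes the right side `⊤`). -/
def BlockBound (σ α : ℝ) (a ρ θ : ℝ → T3 → ℝ) (u : ℝ → T3 → V3) (t : ℝ) : Prop :=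
  ∀ K : ℝ, 0 < K → ∃ C : ℝ, 0 < C ∧ ∃ ε : ℕ → ℝ, Tendsto ε atTop (𝓝 0) ∧
    ∀ s ∈ Set.Icc 0 t, ∀ (N : ℕ) (Ψ : Flow σ N) (μ : Measure (Config (N + 1) (Fin 3) T3)),
      IsProbabilityMeasure μ →
        ∫⁻ z, ENNReal.ofReal (quadFluct K (blockScale α N) (ρ s) (θ s) (u s) z) ∂μ ≤
          ENNReal.ofReal C * (klDiv μ (localGibbsLaw σ (a s) (u s) (θ s) N Ψ) / ((N : ℝ≥0∞) + 1)) +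
            ENNReal.ofReal (ε N)

/-- PACKING-TAIL BOUND on `[0, t]` at threshold `η'` and scale exponent `α`, along the true evolution from the
local Gibbs law: the `(1 + e_h + |p_h|)`-weighted volume of blocks of packing `ρ_h σ³ > η'` has mean `≤ δ` for
`N ≥ N₀(δ)`, uniformly in `s ≤ t` (the inner `∫ x` is the crux's own Bochner integral, as in `MesoFluxClosure`). -/
def PackingTailBound (σ η' α : ℝ) (a₀ θ₀ : T3 → ℝ) (u₀ : T3 → V3) (Φ : (N : ℕ) → Flow σ N) (t : ℝ) : Prop :=
  ∀ δ : ℝ, 0 < δ → ∃ N₀ : ℕ, ∀ N : ℕ, N₀ ≤ N → ∀ s ∈ Set.Icc 0 t,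
    ∫⁻ z, ENNReal.ofReal (∫ x,
        (1 + blockEnergy (blockScale α N) ((Φ N).flow s z) x +
            |blockPressure σ (blockScale α N) ((Φ N).flow s z) x|) *
          (if η' < blockDensity (blockScale α N) ((Φ N).flow s z) x * σ ^ 3 then (1 : ℝ) else 0))
      ∂(localGibbsLaw σ a₀ u₀ θ₀ N (Φ N)) ≤ ENNReal.ofReal δ

/-! ### The statements of the line (named `Prop`s) -/

/-- **S1 · InitialPinning** (M; provable now). Along the data prefix of the crux: if the empirical fields of the
initial local Gibbs laws converge in probability at `t = 0` to `(ρ, ρu, E)(0)` of a classical solution on `[0,T)`,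
`0 < T`, then `u 0 = u₀`, `θ 0 = θ₀`, and the initial law's DENSITY field concentrates exponentially around `ρ 0`
(uniformly over flows). Proof route: landed `HeatBathForgetting.LocalGibbsConcentration` (∃ ρ₀ with exponential
concentration) + uniqueness of limits in probability (`∫ χ ρ₀ = ∫ χ ρ 0` for all continuous `χ`) + continuity
(`ρ 0`, `u 0`, `θ 0` are slices of a jointly smooth solution) + `ρ > 0`. -/
def InitialPinning : Prop :=
  ∀ (a₀ θ₀ : T3 → ℝ) (u₀ : T3 → V3), Continuous a₀ → Continuous θ₀ → Continuous u₀ →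
    (∀ x, 0 < a₀ x) → (∀ x, 0 < θ₀ x) →
    ∃ σ₀ : ℝ, 0 < σ₀ ∧ ∀ σ : ℝ, 0 < σ → σ < σ₀ →
      ∀ (T : ℝ) (ρ θ : ℝ → T3 → ℝ) (u : ℝ → T3 → V3), IsHardSphereEulerSolution σ T ρ u θ →
        ∀ Φ : (N : ℕ) → Flow σ N,
          TendstoHydroFieldsAt (fun N => localGibbsLaw σ a₀ u₀ θ₀ N (Φ N)) Φ ρ u θ 0 → 0 < T →
            u 0 = u₀ ∧ θ 0 = θ₀ ∧
            ∀ χ : T3 → ℝ, Continuous χ → ∀ δ : ℝ, 0 < δ → ∃ C : ℝ, 0 < C ∧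
              ∀ (N : ℕ) (Ψ : Flow σ N),
                localGibbsLaw σ a₀ u₀ θ₀ N Ψ {z | δ < |empiricalDensityField z χ - ∫ x, χ x * ρ 0 x|}
                  ≤ expBound C N

/-- **S2 · ReferenceFitInBand** (L; statics — inverse equation of state along the solution). There is a packing
threshold `η₂ > 0` such that, along the crux's data prefix, for a classical solution pinned at `t = 0`
(`u 0 = u₀`, `θ 0 = θ₀`, density LLN of the initial law around `ρ 0`) and every `t < T` with
`ρ_s σ³ < η₂` on `[0,t] × 𝕋³`, there is an activity family `a`, jointly smooth and positive on `[0,t]`, with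
`localGibbsLaw σ (a 0) (u 0) (θ 0) = localGibbsLaw σ a₀ u₀ θ₀` (same MEASURE: activity inversion is unique up
to a positive scale, to which the canonical law is blind) and `FitOn σ a ρ θ u t`. Intended witness:
`a s = thermoActivity σ (ρ s)` (analytic in `ρ_s σ³` inside the band, HsEosLowDensity PROVED), concentration by
the tree's cluster-expansion statics (`thermoActivity_concentration`, `ActivityInversionDilute`), unit mass of
`ρ_s` from `ρ 0` (LLN) and the continuity equation. -/
def ReferenceFitInBand : Prop :=
  ∃ η₂ : ℝ, 0 < η₂ ∧
  ∀ (a₀ θ₀ : T3 → ℝ) (u₀ : T3 → V3), Continuous a₀ → Continuous θ₀ → Continuous u₀ →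
    (∀ x, 0 < a₀ x) → (∀ x, 0 < θ₀ x) →
    ∃ σ₀ : ℝ, 0 < σ₀ ∧ ∀ σ : ℝ, 0 < σ → σ < σ₀ →
      ∀ (T : ℝ) (ρ θ : ℝ → T3 → ℝ) (u : ℝ → T3 → V3), IsHardSphereEulerSolution σ T ρ u θ →
        u 0 = u₀ → θ 0 = θ₀ →
        (∀ χ : T3 → ℝ, Continuous χ → ∀ δ : ℝ, 0 < δ → ∃ C : ℝ, 0 < C ∧ ∀ (N : ℕ) (Ψ : Flow σ N),
            localGibbsLaw σ a₀ u₀ θ₀ N Ψ {z | δ < |empiricalDensityField z χ - ∫ x, χ x * ρ 0 x|}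
              ≤ expBound C N) →
        ∀ t ∈ Set.Ico 0 T, (∀ s ∈ Set.Icc 0 t, ∀ x, ρ s x * σ ^ 3 < η₂) →
          ∃ a : ℝ → T3 → ℝ, Torus.IsSmoothSpaceTimeOn (Set.Icc 0 t) a ∧ (∀ s ∈ Set.Icc 0 t, ∀ x, 0 < a s x) ∧
            (∀ (N : ℕ) (Ψ : Flow σ N), localGibbsLaw σ (a 0) (u 0) (θ 0) N Ψ = localGibbsLaw σ a₀ u₀ θ₀ N Ψ) ∧
            FitOn σ a ρ θ u t

/-- **S3 · BlockFluctuationsInBand** (L; statics — the "mesoscopic pressure functional"). There is a packing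
threshold `η₃ > 0` such that for every block exponent `0 < α < 1/3` (blocks of `(N+1)^{1-3α} → ∞` particles),
every `0 < σ ≤ 1/2`, every classical solution with `ρ_s σ³ < η₃` on `[0,t]`, and every smooth positive activity
family fitted to it on `[0,t]`, the BLOCK BOUND holds: entropy inequality
`E_μ[X] ≤ γ⁻¹ (H(μ|ψ_s) + log E_{ψ_s} e^{γ X})` with `X = (N+1) · quadFluct_K`, and
`log E_{ψ_s} exp(γ₀ (N+1) quadFluct_K) = o(N+1)` for `γ₀ = γ₀(K) > 0` by block large deviations of the dilute
inhomogeneous canonical hard-sphere gas (cluster expansion: sub-Gaussian truncated block means, approximate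
independence of disjoint blocks) and independent local Maxwellians for the velocity blocks. -/
def BlockFluctuationsInBand : Prop :=
  ∃ η₃ : ℝ, 0 < η₃ ∧ ∀ α : ℝ, 0 < α → α < 1 / 3 →
    ∀ σ : ℝ, 0 < σ → σ ≤ 1 / 2 →
      ∀ (T : ℝ) (ρ θ : ℝ → T3 → ℝ) (u : ℝ → T3 → V3), IsHardSphereEulerSolution σ T ρ u θ →
        ∀ t ∈ Set.Ico 0 T, (∀ s ∈ Set.Icc 0 t, ∀ x, ρ s x * σ ^ 3 < η₃) →
          ∀ a : ℝ → T3 → ℝ, Torus.IsSmoothSpaceTimeOn (Set.Icc 0 t) a → (∀ s ∈ Set.Icc 0 t, ∀ x, 0 < a s x) →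
            FitOn σ a ρ θ u t → BlockBound σ α a ρ θ u t

/-- **S4 · BlockPackingTails** (L / open; a-priori, the density twin of `CubicMomentUI`). For every threshold
`η' > 0`, along the crux's data prefix and the true evolution from local Gibbs data, for every block exponent
`0 < α < 1/3` and every `t < T` such that the Euler packing stays below `η'/2` on `[0,t]`, the PACKING-TAIL BOUND
holds at threshold `η'`. Why it might fail: a persistent sub-population of over-compressed mesoscopic clusters
generated by the deterministic dynamics (nothing a priori forbids it at fixed reduced density; the entropy
method cannot see events of cost `n_h ≪ N`), or the junk branch of `hsPressure` near close packing making the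
`|p_h|` weight non-integrable in mean. -/
def BlockPackingTails : Prop :=
  ∀ η' : ℝ, 0 < η' →
  ∀ (a₀ θ₀ : T3 → ℝ) (u₀ : T3 → V3), Continuous a₀ → Continuous θ₀ → Continuous u₀ →
    (∀ x, 0 < a₀ x) → (∀ x, 0 < θ₀ x) →
    ∃ σ₀ : ℝ, 0 < σ₀ ∧ ∀ σ : ℝ, 0 < σ → σ < σ₀ →
      ∀ (T : ℝ) (ρ θ : ℝ → T3 → ℝ) (u : ℝ → T3 → V3), IsHardSphereEulerSolution σ T ρ u θ →
        ∀ Φ : (N : ℕ) → Flow σ N,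
          TendstoHydroFieldsAt (fun N => localGibbsLaw σ a₀ u₀ θ₀ N (Φ N)) Φ ρ u θ 0 →
            ∀ α : ℝ, 0 < α → α < 1 / 3 →
              ∀ t ∈ Set.Ico 0 T, (∀ s ∈ Set.Icc 0 t, ∀ x, ρ s x * σ ^ 3 < η' / 2) →
                PackingTailBound σ η' α a₀ θ₀ u₀ Φ t

/-- **S5 · EntropyGronwall** (XL; HARDEST — Yau's identity and Grönwall, given everything else). There is a
packing threshold `η₄ > 0` (the prover takes `2η₄` inside the analyticity band of HsEosLowDensity) such that,
given `MesoFluxClosure` (one-block input in mean, with its own block exponent `α`) and `CubicMomentUI`, along the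
crux's data prefix, the true evolution and a `t < T` with Euler packing `< η₄` on `[0,t]`: for every smooth
positive activity family `a` on `[0,t]` whose time-`0` law IS the initial law, fitted on `[0,t]`, with the block
bound at every exponent and the packing-tail bound at threshold `2η₄` at every exponent, the specific relative
entropy `H(f_t | ψ_t)/(N+1)` tends to `0`. Content: exact entropy identity for the measure-preserving flow,
`log ψ_s` linear in the empirical conserved fields, field increments from `MesoFluxClosure` (energy, momentum)
and from exact free transport of mass (continuity of positions on hard-sphere trajectories — proved inside),
cancellation of the linear part by the Euler equations in entropy variables and `d/ds log Z_N`, quadratic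
remainder by the block bound, large fields by `CubicMomentUI` and the packing tails, `H(0) = 0`, Grönwall.
Why it might fail: the time-discretisation needs the `MesoFluxClosure` error `δ` uniformly over the finitely many
test functions `λ_{s_j}` AND over windows (fine: `N₀` after the partition), but the remainder on blocks with small
`ρ_h` (vacuum pockets: `m_h/ρ_h` large at bounded energy) is controlled by neither hypothesis unless Hölder
`e_h^{3/2} ρ_h^{-1/2} ≲` block `|v|³` closes it — the stub's own bet. -/
def EntropyGronwall : Prop :=
  ∃ η₄ : ℝ, 0 < η₄ ∧ (MesoFluxClosure → CubicMomentUI →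
  ∀ (a₀ θ₀ : T3 → ℝ) (u₀ : T3 → V3), Continuous a₀ → Continuous θ₀ → Continuous u₀ →
    (∀ x, 0 < a₀ x) → (∀ x, 0 < θ₀ x) →
    ∃ σ₀ : ℝ, 0 < σ₀ ∧ ∀ σ : ℝ, 0 < σ → σ < σ₀ →
      ∀ (T : ℝ) (ρ θ : ℝ → T3 → ℝ) (u : ℝ → T3 → V3), IsHardSphereEulerSolution σ T ρ u θ →
        ∀ Φ : (N : ℕ) → Flow σ N,
          TendstoHydroFieldsAt (fun N => localGibbsLaw σ a₀ u₀ θ₀ N (Φ N)) Φ ρ u θ 0 →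
            ∀ t ∈ Set.Ico 0 T, (∀ s ∈ Set.Icc 0 t, ∀ x, ρ s x * σ ^ 3 < η₄) →
              ∀ a : ℝ → T3 → ℝ, Torus.IsSmoothSpaceTimeOn (Set.Icc 0 t) a →
                (∀ s ∈ Set.Icc 0 t, ∀ x, 0 < a s x) →
                (∀ N : ℕ, localGibbsLaw σ (a 0) (u 0) (θ 0) N (Φ N) = localGibbsLaw σ a₀ u₀ θ₀ N (Φ N)) →
                FitOn σ a ρ θ u t →
                (∀ α : ℝ, 0 < α → α < 1 / 3 → BlockBound σ α a ρ θ u t) →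
                (∀ α : ℝ, 0 < α → α < 1 / 3 → PackingTailBound σ (2 * η₄) α a₀ θ₀ u₀ Φ t) →
                  Tendsto (fun N : ℕ =>
                    klDiv ((Φ N).lawAt (localGibbsLaw σ a₀ u₀ θ₀ N (Φ N)) t)
                      (localGibbsLaw σ (a t) (u t) (θ t) N (Φ N)) / ((N : ℝ≥0∞) + 1)) atTop (𝓝 0))

/-! ### Registered stubs (the open obligations of the line; `sorry` only here) -/

/-- STUB S1 (M; provable now from landed LocalGibbsConcentration + uniqueness of limits). -/
theorem stub_initialPinning : InitialPinning := by
  sorry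

/-- STUB S2 (L; statics: inverse equation of state along the solution, in band). -/
theorem stub_referenceFitInBand : ReferenceFitInBand := by
  sorry

/-- STUB S3 (L; statics: entropy-inequality form of the block large-deviation bound, in band). -/
theorem stub_blockFluctuationsInBand : BlockFluctuationsInBand := by
  sorry

/-- STUB S4 (L / open; a-priori mesoscopic packing tails along the true evolution). -/
theorem stub_blockPackingTails : BlockPackingTails := by
  sorry

/-- STUB S5 (XL; HARDEST — Yau's identity + Grönwall given the one-block input in mean). -/
theorem stub_entropyGronwall : EntropyGronwall := by
  sorry

/-! ### Name-keyed aliases of the stub statements (the hypotheses of the composition; the skeleton audit admits a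
hypothesis only if its head constant is a registered obligation or is named like a declared stub) -/
namespace Registered

/-- Alias of `InitialPinning` keyed by the registered stub name. -/
abbrev stub_initialPinning : Prop := InitialPinning
/-- Alias of `ReferenceFitInBand` keyed by the registered stub name. -/
abbrev stub_referenceFitInBand : Prop := ReferenceFitInBand
/-- Alias of `BlockFluctuationsInBand` keyed by the registered stub name. -/
abbrev stub_blockFluctuationsInBand : Prop := BlockFluctuationsInBand
/-- Alias of `BlockPackingTails` keyed by the registered stub name. -/
abbrev stub_blockPackingTails : Prop := BlockPackingTails
/-- Alias of `EntropyGronwall` keyed by the registered stub name. -/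
abbrev stub_entropyGronwall : Prop := EntropyGronwall

end Registered

/-! ### Composition (PROVED): the five stubs and the shared item `DiluteSelfConsistency` give the crux BY NAME -/

/-- **The line concludes the crux BY NAME.** `InitialPinning → ReferenceFitInBand → BlockFluctuationsInBand →
BlockPackingTails → EntropyGronwall → ImplosionDichotomy.DiluteSelfConsistency → ClosureToEntropy`
(no `sorry`): thresholds `η = min η₂ (min η₃ η₄)`, `σ₀ = min (1/2) (min σ₁ (min σ₂ (min σ₄ (min σ₅ σ_D))))`;
the first conjunct of the crux by `isProbabilityMeasure_localGibbsLaw` (`σ ≤ 1/2`); the guard on `[0,t]` from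
`DiluteSelfConsistency`; pinning ⇒ fitted family `a` ⇒ block bound and packing tails at every exponent ⇒
Grönwall; the crux's witness activity at time `t` is `a t` and its concentration clause is the fit at `s = t`. -/
theorem ClosureToEntropy_of (h1 : Registered.stub_initialPinning) (h2 : Registered.stub_referenceFitInBand)
    (h3 : Registered.stub_blockFluctuationsInBand) (h4 : Registered.stub_blockPackingTails)
    (h5 : Registered.stub_entropyGronwall) (hD : ImplosionDichotomy.DiluteSelfConsistency) :
    ClosureToEntropy := by
  intro hMFC hCM a₀ θ₀ u₀ ha hθ hu ha0 hθ0
  obtain ⟨η₂, hη₂, H2⟩ := h2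
  obtain ⟨η₃, hη₃, H3⟩ := h3
  obtain ⟨η₄, hη₄, H5⟩ := h5
  set η : ℝ := min η₂ (min η₃ η₄) with hηdef
  have hη : 0 < η := lt_min hη₂ (lt_min hη₃ hη₄)
  have hη2 : η ≤ η₂ := min_le_left _ _
  have hη3 : η ≤ η₃ := (min_le_right _ _).trans (min_le_left _ _)
  have hη4 : η ≤ η₄ := (min_le_right _ _).trans (min_le_right _ _)
  obtain ⟨σ₁, hσ₁, P1⟩ := h1 a₀ θ₀ u₀ ha hθ hu ha0 hθ0
  obtain ⟨σ₂, hσ₂, P2⟩ := H2 a₀ θ₀ u₀ ha hθ hu ha0 hθ0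
  obtain ⟨σ₄, hσ₄, P4⟩ := h4 (2 * η₄) (by positivity) a₀ θ₀ u₀ ha hθ hu ha0 hθ0
  obtain ⟨σ₅, hσ₅, P5⟩ := H5 hMFC hCM a₀ θ₀ u₀ ha hθ hu ha0 hθ0
  obtain ⟨σ₆, hσ₆, PD⟩ := hD η hη a₀ θ₀ u₀ ha hθ hu ha0 hθ0
  refine ⟨min (1 / 2) (min σ₁ (min σ₂ (min σ₄ (min σ₅ σ₆)))),
    lt_min one_half_pos (lt_min hσ₁ (lt_min hσ₂ (lt_min hσ₄ (lt_min hσ₅ hσ₆)))), ?_⟩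
  intro σ hσ hσlt T ρ θ u hE Φ
  have hσhalf : σ ≤ 1 / 2 := (le_of_lt hσlt).trans (min_le_left _ _)
  have hrest : σ < min σ₁ (min σ₂ (min σ₄ (min σ₅ σ₆))) := lt_of_lt_of_le hσlt (min_le_right _ _)
  have hσ1 : σ < σ₁ := lt_of_lt_of_le hrest (min_le_left _ _)
  have hσ2 : σ < σ₂ := lt_of_lt_of_le hrest ((min_le_right _ _).trans (min_le_left _ _))
  have hσ4 : σ < σ₄ :=
    lt_of_lt_of_le hrest ((min_le_right _ _).trans ((min_le_right _ _).trans (min_le_left _ _)))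
  have hσ5 : σ < σ₅ := lt_of_lt_of_le hrest
    ((min_le_right _ _).trans ((min_le_right _ _).trans ((min_le_right _ _).trans (min_le_left _ _))))
  have hσ6 : σ < σ₆ := lt_of_lt_of_le hrest
    ((min_le_right _ _).trans ((min_le_right _ _).trans ((min_le_right _ _).trans (min_le_right _ _))))
  refine ⟨fun N => isProbabilityMeasure_localGibbsLaw ha hθ hu ha0 hθ0 hσhalf N (Φ N), ?_⟩
  intro h0 t ht
  have hT : 0 < T := lt_of_le_of_lt ht.1 ht.2
  -- the packing guard on `[0, t]` from `DiluteSelfConsistency`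
  have hguard : ∀ s ∈ Set.Icc 0 t, ∀ x, ρ s x * σ ^ 3 < η := fun s hs x =>
    PD σ hσ hσ6 T ρ θ u hE Φ h0 s ⟨hs.1, lt_of_le_of_lt hs.2 ht.2⟩ x
  -- pinning at `t = 0`
  obtain ⟨hu0, hθ0', hdens⟩ := P1 σ hσ hσ1 T ρ θ u hE Φ h0 hT
  -- the fitted reference family on `[0, t]`
  obtain ⟨a, ha_smooth, ha_pos, hlaw0, hfit⟩ :=
    P2 σ hσ hσ2 T ρ θ u hE hu0 hθ0' hdens t ht (fun s hs x => lt_of_lt_of_le (hguard s hs x) hη2)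
  -- block bound (statics) and packing tails (a priori) at every block exponent
  have hBB : ∀ α : ℝ, 0 < α → α < 1 / 3 → BlockBound σ α a ρ θ u t := fun α hα hα' =>
    H3 α hα hα' σ hσ hσhalf T ρ θ u hE t ht (fun s hs x => lt_of_lt_of_le (hguard s hs x) hη3)
      a ha_smooth ha_pos hfit
  have hPT : ∀ α : ℝ, 0 < α → α < 1 / 3 → PackingTailBound σ (2 * η₄) α a₀ θ₀ u₀ Φ t := fun α hα hα' =>
    P4 σ hσ hσ4 T ρ θ u hE Φ h0 α hα hα' t ht (fun s hs x => by
      have := lt_of_lt_of_le (hguard s hs x) hη4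
      linarith)
  -- Yau's Grönwall
  have hKL := P5 σ hσ hσ5 T ρ θ u hE Φ h0 t ht (fun s hs x => lt_of_lt_of_le (hguard s hs x) hη4)
    a ha_smooth ha_pos (fun N => hlaw0 N (Φ N)) hfit hBB hPT
  have htt : t ∈ Set.Icc 0 t := ⟨ht.1, le_rfl⟩
  refine ⟨a t, fun N => hfit.1 t htt N (Φ N), ?_, hKL⟩
  intro χ hχ δ hδ
  obtain ⟨C, hC, HC⟩ := hfit.2 χ hχ δ hδ
  exact ⟨C, hC, fun N => HC t htt N (Φ N)⟩

/-- Wiring check: the registered stubs (and the shared item, here as a hypothesis) feed `ClosureToEntropy_of`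
as stated. -/
example (hD : ImplosionDichotomy.DiluteSelfConsistency) : ClosureToEntropy :=
  ClosureToEntropy_of stub_initialPinning stub_referenceFitInBand stub_blockFluctuationsInBand
    stub_blockPackingTails stub_entropyGronwall hD

end Summit.AtomisticToContinuum.HydrodynamicLimit.Cruxes.ClosureToEntropy.Birth

end
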